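import Summits.CriticalPhenomena.PercolationContinuityZ3.Theorems.PercNearOneGluingNoHeavyLowerTailC3Transport
import HarnessLib
import HarnessLib.Audit

/-!
# `NoHeavyLowerTail` (crux stmt-CriticalPhenomena-4575), Sahi programme P4: the SATURATION REDUCTION for Sahi's `C₃`
# — `E₃` decreases when a slot is grown outside the core `A ∩ B` or shrunk inside it, so `C₃` only has to be checked on
# "bi-saturated" triples

Support file (cell `prim-l12`, seat P4 "Holley / monotone coupling / transport"; `--supports stmt-CriticalPhenomena-4575`).
No named facts, no conjectures, no sorries.

SETTING.  `α` a finite distributive lattice, `μ : α → ℝ` a nonnegative log-supermodular (FKG) weight, `latticeE3 μ U A B`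
Sahi's third functional (homogeneous form, `Literature.Probability.LatticeModels.latticeE3`), `density μ A B z` its first-slot
density (`…C3Transport`: `latticeE3 μ U A B = Σ_{z∈U} μ z · density μ A B z`).

RESULTS (all slots are symmetric — `latticeE3_comm₁₂/₂₃/₁₃` of `…SahiC3CubeThreeFKGPrelim` — so we state the first slot only):
* `density_nonpos_of_not_mem` / `density_nonneg_of_mem` — the density is `≤ 0` OFF the core `A ∩ B` (this is the FKG inequality
  `m(A)m(B) ≤ Z·m(A∩B)`) and `≥ 0` ON the core (`= (Z−m(A))(Z−m(B)) + Z(Z−m(A∩B))`).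
* `latticeE3_sub_eq_sum_sdiff` — for `U ⊆ U'`: `E₃(U',A,B) − E₃(U,A,B) = Σ_{z ∈ U'∖U} μ z · density`.
* `latticeE3_le_of_subset_of_forall_not_mem` — growing the first slot by points OUTSIDE `A ∩ B` can only DECREASE `E₃`;
  `latticeE3_le_of_subset_of_forall_mem` — shrinking it by points INSIDE `A ∩ B` can only DECREASE `E₃`.
* The two saturation operators of an up-set `U` relative to the core `K = A ∩ B`:
  `coreSat A B U = {x | ↑x ∩ K ⊆ U}` (the LARGEST up-set with the same trace on `K`; adds only non-core points) and
  `genSat A B U = ↑(U ∖ K)` (the SMALLEST up-set with the same trace off `K`; removes only core points); both are up-sets,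
  `genSat ⊆ U ⊆ coreSat`, and `latticeE3_coreSat_le`, `latticeE3_genSat_le`: each has `E₃ ≤ E₃(U,A,B)`.
* **`forall_latticeE3_nonneg_of_saturated`** (the reduction): if `latticeE3 μ U A B ≥ 0` for every BI-SATURATED up-set `U`
  (`coreSat A B U = U ∧ genSat A B U = U`, i.e. every minimal element of `U` lies outside `A ∩ B` and every maximal non-element
  of `U` lies inside `A ∩ B`), then it holds for EVERY up-set `U`.  Proof: the potential `#(U∖K) + #(K∖U) ≤ #α` strictly
  increases under each non-trivial saturation move.
Consequence for the programme: Sahi's `C₃` (Kahn's Conjecture 5, indicator form) for a given FKG weight is equivalent to its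
restriction to triples that are bi-saturated in all three slots simultaneously (apply the reduction slot by slot; the same
potential summed over the three slots increases).  Census (seat, exact): the nontrivial triples of up-sets of `{0,1}^k` that are
bi-saturated in all three slots number 2 (k = 3: `(x₁,x₂,x₃)`, `(x₁∨x₂, x₁∨x₃, x₂∨x₃)`) and 230 in 22 `S₄`-orbits (k = 4), against
1 540 resp. 804 440 multiset triples.  [this work]
-/

namespace Summit.CriticalPhenomena.PercolationContinuityZ3.Theorems.C3Transport

open Finset Literature.Probability.LatticeModels

variable {α : Type*} [Fintype α] [DecidableEq α]

/-! ### Sign of the first-slot density -/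

/-- OFF the core `A ∩ B` the first-slot density is `≤ 0`: it equals `m(A)m(B) − Z·m(A∩B) − Z·m(A)·1_B(z) − Z·m(B)·1_A(z)`,
nonpositive by the FKG inequality for the up-sets `A, B`. [this work] -/
theorem density_nonpos_of_not_mem [DistribLattice α] {μ : α → ℝ} (hμ₀ : 0 ≤ μ)
    (hμ : ∀ a b, μ a * μ b ≤ μ (a ⊓ b) * μ (a ⊔ b)) {A B : Finset α} (hA : IsUpperSet (A : Set α))
    (hB : IsUpperSet (B : Set α)) {z : α} (hz : z ∉ A ∩ B) : density μ A B z ≤ 0 := by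
  have hfkg := fkg_upperSet_mass hμ₀ hμ hA hB
  have hZ := mass_nonneg hμ₀ (univ : Finset α)
  have ha := mass_nonneg hμ₀ A
  have hb := mass_nonneg hμ₀ B
  unfold density
  rw [if_neg hz]
  have h1 : 0 ≤ mass μ univ * mass μ A * (if z ∈ B then (1 : ℝ) else 0) :=
    mul_nonneg (mul_nonneg hZ ha) (by split_ifs <;> norm_num)
  have h2 : 0 ≤ mass μ univ * mass μ B * (if z ∈ A then (1 : ℝ) else 0) :=
    mul_nonneg (mul_nonneg hZ hb) (by split_ifs <;> norm_num)
  linarith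

omit [DecidableEq α] in
/-- Masses are at most the total mass. [folklore] -/
private theorem mass_le_univ {μ : α → ℝ} (hμ₀ : 0 ≤ μ) [DecidableEq α] (S : Finset α) : mass μ S ≤ mass μ univ :=
  mass_mono hμ₀ (Finset.subset_univ S)

/-- ON the core `A ∩ B` the first-slot density is `≥ 0`: it equals `(Z − m(A))(Z − m(B)) + Z·(Z − m(A∩B))`. [this work] -/
theorem density_nonneg_of_mem {μ : α → ℝ} (hμ₀ : 0 ≤ μ) {A B : Finset α} {z : α} (hz : z ∈ A ∩ B) :
    0 ≤ density μ A B z := by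
  have hzA : z ∈ A := (Finset.mem_inter.1 hz).1
  have hzB : z ∈ B := (Finset.mem_inter.1 hz).2
  have hZ := mass_nonneg hμ₀ (univ : Finset α)
  have ha := mass_le_univ hμ₀ A
  have hb := mass_le_univ hμ₀ B
  have hab := mass_le_univ hμ₀ (A ∩ B)
  have key : density μ A B z =
      (mass μ univ - mass μ A) * (mass μ univ - mass μ B) + mass μ univ * (mass μ univ - mass μ (A ∩ B)) := by
    unfold density; rw [if_pos hz, if_pos hzA, if_pos hzB]; ring
  rw [key]
  exact add_nonneg (mul_nonneg (sub_nonneg.2 ha) (sub_nonneg.2 hb)) (mul_nonneg hZ (sub_nonneg.2 hab))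

/-! ### Growing outside the core and shrinking inside the core both decrease `E₃` -/

/-- For `U ⊆ U'`: `latticeE3 μ U' A B − latticeE3 μ U A B = Σ_{z ∈ U' ∖ U} μ z · density μ A B z` (first-slot linearity).
[this work] -/
theorem latticeE3_sub_eq_sum_sdiff (μ : α → ℝ) (A B : Finset α) {U U' : Finset α} (h : U ⊆ U') :
    latticeE3 μ U' A B - latticeE3 μ U A B = ∑ z ∈ U' \ U, μ z * density μ A B z := by
  rw [latticeE3_eq_sum_density, latticeE3_eq_sum_density, ← Finset.sum_sdiff h]
  ring

/-- **Growing the first slot outside the core decreases `E₃`.**  If `U ⊆ U'` and every added point lies outside `A ∩ B`,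
then `latticeE3 μ U' A B ≤ latticeE3 μ U A B` (up-sets `A, B`, FKG weight; `U, U'` arbitrary). [this work] -/
theorem latticeE3_le_of_subset_of_forall_not_mem [DistribLattice α] {μ : α → ℝ} (hμ₀ : 0 ≤ μ)
    (hμ : ∀ a b, μ a * μ b ≤ μ (a ⊓ b) * μ (a ⊔ b)) {A B : Finset α} (hA : IsUpperSet (A : Set α))
    (hB : IsUpperSet (B : Set α)) {U U' : Finset α} (h : U ⊆ U') (hout : ∀ z ∈ U' \ U, z ∉ A ∩ B) :
    latticeE3 μ U' A B ≤ latticeE3 μ U A B := by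
  have hs := latticeE3_sub_eq_sum_sdiff μ A B h
  have hle : ∑ z ∈ U' \ U, μ z * density μ A B z ≤ 0 :=
    Finset.sum_nonpos fun z hz => mul_nonpos_of_nonneg_of_nonpos (hμ₀ z) (density_nonpos_of_not_mem hμ₀ hμ hA hB (hout z hz))
  linarith

/-- **Shrinking the first slot inside the core decreases `E₃`.**  If `U ⊆ U'` and every point of `U' ∖ U` lies inside
`A ∩ B`, then `latticeE3 μ U A B ≤ latticeE3 μ U' A B` (nonnegative weight; no lattice structure needed). [this work] -/
theorem latticeE3_le_of_subset_of_forall_mem {μ : α → ℝ} (hμ₀ : 0 ≤ μ) {A B : Finset α} {U U' : Finset α}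
    (h : U ⊆ U') (hin : ∀ z ∈ U' \ U, z ∈ A ∩ B) : latticeE3 μ U A B ≤ latticeE3 μ U' A B := by
  have hs := latticeE3_sub_eq_sum_sdiff μ A B h
  have hle : 0 ≤ ∑ z ∈ U' \ U, μ z * density μ A B z :=
    Finset.sum_nonneg fun z hz => mul_nonneg (hμ₀ z) (density_nonneg_of_mem hμ₀ (hin z hz))
  linarith

/-! ### The saturation potential -/

/-- The saturation potential `#(U ∖ K) + #(K ∖ U)`, `K = A ∩ B`. [this work] -/
def satPot (A B U : Finset α) : ℕ := (U \ (A ∩ B)).card + ((A ∩ B) \ U).card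

/-- The potential is at most the size of the lattice. [this work] -/
theorem satPot_le_card (A B U : Finset α) : satPot A B U ≤ Fintype.card α := by
  unfold satPot
  rw [← Finset.card_union_of_disjoint]
  · exact Finset.card_le_univ _
  · rw [Finset.disjoint_left]
    intro z hz hz'
    exact (Finset.mem_sdiff.1 hz).2 (Finset.mem_sdiff.1 hz').1

/-! ### The two saturation operators -/

section Saturation

variable [PartialOrder α] [DecidableLE α]

/-- `coreSat A B U = {x | every y ≥ x in the core A ∩ B lies in U}`: the largest up-set whose trace on `A ∩ B` is that of the
up-set `U`. [this work] -/
def coreSat (A B U : Finset α) : Finset α :=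
  univ.filter fun x => ∀ y ∈ A ∩ B, x ≤ y → y ∈ U

/-- `genSat A B U = ↑(U ∖ (A ∩ B))`: the up-set generated by the non-core part of `U` (the smallest up-set whose trace off
`A ∩ B` is that of the up-set `U`). [this work] -/
def genSat (A B U : Finset α) : Finset α :=
  univ.filter fun x => ∃ y ∈ U \ (A ∩ B), y ≤ x

omit [DecidableEq α] in
/-- Membership in `coreSat`. [this work] -/
theorem mem_coreSat [DecidableEq α] {A B U : Finset α} {x : α} :
    x ∈ coreSat A B U ↔ ∀ y ∈ A ∩ B, x ≤ y → y ∈ U := by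
  simp [coreSat]

omit [DecidableEq α] in
/-- Membership in `genSat`. [this work] -/
theorem mem_genSat [DecidableEq α] {A B U : Finset α} {x : α} :
    x ∈ genSat A B U ↔ ∃ y ∈ U \ (A ∩ B), y ≤ x := by
  simp only [genSat, Finset.mem_filter, Finset.mem_univ, true_and]

/-- `coreSat A B U` is an up-set. [this work] -/
theorem isUpperSet_coreSat (A B U : Finset α) : IsUpperSet ((coreSat A B U : Finset α) : Set α) := by
  intro x x' hxx' hx
  rw [Finset.mem_coe, mem_coreSat] at hx ⊢
  exact fun y hy hx'y => hx y hy (le_trans hxx' hx'y)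

/-- `genSat A B U` is an up-set. [this work] -/
theorem isUpperSet_genSat (A B U : Finset α) : IsUpperSet ((genSat A B U : Finset α) : Set α) := by
  intro x x' hxx' hx
  rw [Finset.mem_coe, mem_genSat] at hx ⊢
  obtain ⟨y, hy, hyx⟩ := hx
  exact ⟨y, hy, le_trans hyx hxx'⟩

/-- An up-set is contained in its core saturation. [this work] -/
theorem subset_coreSat {A B U : Finset α} (hU : IsUpperSet (U : Set α)) : U ⊆ coreSat A B U := by
  intro x hx
  rw [mem_coreSat]
  intro y _ hxy
  exact hU hxy hx

/-- The generated saturation is contained in the up-set. [this work] -/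
theorem genSat_subset {A B U : Finset α} (hU : IsUpperSet (U : Set α)) : genSat A B U ⊆ U := by
  intro x hx
  rw [mem_genSat] at hx
  obtain ⟨y, hy, hyx⟩ := hx
  exact hU hyx (Finset.mem_sdiff.1 hy).1

/-- The points that `coreSat` adds lie outside the core. [this work] -/
theorem not_mem_inter_of_mem_coreSat_sdiff {A B U : Finset α} {z : α} (hz : z ∈ coreSat A B U \ U) : z ∉ A ∩ B := by
  intro hzK
  obtain ⟨hz1, hz2⟩ := Finset.mem_sdiff.1 hz
  exact hz2 ((mem_coreSat.1 hz1) z hzK le_rfl)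

/-- The points that `genSat` removes lie inside the core. [this work] -/
theorem mem_inter_of_mem_sdiff_genSat {A B U : Finset α} {z : α} (hz : z ∈ U \ genSat A B U) : z ∈ A ∩ B := by
  by_contra hzK
  obtain ⟨hz1, hz2⟩ := Finset.mem_sdiff.1 hz
  exact hz2 (mem_genSat.2 ⟨z, Finset.mem_sdiff.2 ⟨hz1, hzK⟩, le_rfl⟩)

/-- **Generated saturation decreases `E₃`**: `latticeE3 μ (genSat A B U) A B ≤ latticeE3 μ U A B` for an up-set `U` under a
nonnegative weight. [this work] -/
theorem latticeE3_genSat_le {μ : α → ℝ} (hμ₀ : 0 ≤ μ) {U A B : Finset α} (hU : IsUpperSet (U : Set α)) :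
    latticeE3 μ (genSat A B U) A B ≤ latticeE3 μ U A B :=
  latticeE3_le_of_subset_of_forall_mem hμ₀ (genSat_subset hU) fun _ hz => mem_inter_of_mem_sdiff_genSat hz

/-! ### The potential and the reduction to bi-saturated first slots -/

/-- A non-trivial core saturation strictly increases the potential. [this work] -/
theorem satPot_lt_coreSat {A B U : Finset α} (hU : IsUpperSet (U : Set α)) (hne : coreSat A B U ≠ U) :
    satPot A B U < satPot A B (coreSat A B U) := by
  have hsub := subset_coreSat (A := A) (B := B) hU
  have h1 : U \ (A ∩ B) ⊂ coreSat A B U \ (A ∩ B) := by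
    refine Finset.ssubset_iff_subset_ne.2 ⟨Finset.sdiff_subset_sdiff hsub le_rfl, ?_⟩
    intro heq
    apply hne
    refine Finset.Subset.antisymm ?_ hsub
    intro z hz
    by_contra hzU
    have hzK : z ∉ A ∩ B := not_mem_inter_of_mem_coreSat_sdiff (Finset.mem_sdiff.2 ⟨hz, hzU⟩)
    have : z ∈ coreSat A B U \ (A ∩ B) := Finset.mem_sdiff.2 ⟨hz, hzK⟩
    rw [← heq] at this
    exact hzU (Finset.mem_sdiff.1 this).1
  have h2 : (A ∩ B) \ U = (A ∩ B) \ coreSat A B U := by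
    ext z
    simp only [Finset.mem_sdiff]
    constructor
    · rintro ⟨hzK, hzU⟩
      exact ⟨hzK, fun hz => not_mem_inter_of_mem_coreSat_sdiff (Finset.mem_sdiff.2 ⟨hz, hzU⟩) hzK⟩
    · rintro ⟨hzK, hz⟩
      exact ⟨hzK, fun hzU => hz (hsub hzU)⟩
  unfold satPot
  rw [← h2]
  exact Nat.add_lt_add_right (Finset.card_lt_card h1) _

/-- A non-trivial generated saturation strictly increases the potential. [this work] -/
theorem satPot_lt_genSat {A B U : Finset α} (hU : IsUpperSet (U : Set α)) (hne : genSat A B U ≠ U) :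
    satPot A B U < satPot A B (genSat A B U) := by
  have hsub := genSat_subset (A := A) (B := B) hU
  have h1 : (A ∩ B) \ U ⊂ (A ∩ B) \ genSat A B U := by
    refine Finset.ssubset_iff_subset_ne.2 ⟨Finset.sdiff_subset_sdiff le_rfl hsub, ?_⟩
    intro heq
    apply hne
    refine Finset.Subset.antisymm hsub ?_
    intro z hz
    by_contra hzG
    have hzK : z ∈ A ∩ B := mem_inter_of_mem_sdiff_genSat (Finset.mem_sdiff.2 ⟨hz, hzG⟩)
    have : z ∈ (A ∩ B) \ genSat A B U := Finset.mem_sdiff.2 ⟨hzK, hzG⟩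
    rw [← heq] at this
    exact (Finset.mem_sdiff.1 this).2 hz
  have h2 : U \ (A ∩ B) = genSat A B U \ (A ∩ B) := by
    ext z
    simp only [Finset.mem_sdiff]
    constructor
    · rintro ⟨hzU, hzK⟩
      exact ⟨mem_genSat.2 ⟨z, Finset.mem_sdiff.2 ⟨hzU, hzK⟩, le_rfl⟩, hzK⟩
    · rintro ⟨hz, hzK⟩
      exact ⟨hsub hz, hzK⟩
  unfold satPot
  rw [← h2]
  exact Nat.add_lt_add_left (Finset.card_lt_card h1) _

end Saturation

section SaturationLattice

variable [DistribLattice α] [DecidableLE α]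

/-- **Core saturation decreases `E₃`**: `latticeE3 μ (coreSat A B U) A B ≤ latticeE3 μ U A B` for up-sets `U, A, B` under an FKG
weight. [this work] -/
theorem latticeE3_coreSat_le {μ : α → ℝ} (hμ₀ : 0 ≤ μ) (hμ : ∀ a b, μ a * μ b ≤ μ (a ⊓ b) * μ (a ⊔ b))
    {U A B : Finset α} (hU : IsUpperSet (U : Set α)) (hA : IsUpperSet (A : Set α)) (hB : IsUpperSet (B : Set α)) :
    latticeE3 μ (coreSat A B U) A B ≤ latticeE3 μ U A B :=
  latticeE3_le_of_subset_of_forall_not_mem hμ₀ hμ hA hB (subset_coreSat hU)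
    fun _ hz => not_mem_inter_of_mem_coreSat_sdiff hz

/-- **The saturation reduction (first slot).**  If `latticeE3 μ U A B ≥ 0` for every up-set `U` that is BI-SATURATED relative
to the core `A ∩ B` (`coreSat A B U = U` and `genSat A B U = U`: its maximal non-elements lie in `A ∩ B`, its minimal elements
outside `A ∩ B`), then `latticeE3 μ U A B ≥ 0` for every up-set `U` — for up-sets `A, B` under an FKG weight on a finite
distributive lattice.  (Apply to each slot in turn, via `latticeE3_comm₁₂/₂₃`, to reduce Sahi's `C₃` to triples bi-saturated in
all three slots.) [this work] -/
theorem forall_latticeE3_nonneg_of_saturated {μ : α → ℝ} (hμ₀ : 0 ≤ μ)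
    (hμ : ∀ a b, μ a * μ b ≤ μ (a ⊓ b) * μ (a ⊔ b)) {A B : Finset α} (hA : IsUpperSet (A : Set α))
    (hB : IsUpperSet (B : Set α))
    (hsat : ∀ U : Finset α, IsUpperSet (U : Set α) → coreSat A B U = U → genSat A B U = U → 0 ≤ latticeE3 μ U A B)
    (U : Finset α) (hU : IsUpperSet (U : Set α)) : 0 ≤ latticeE3 μ U A B := by
  -- induction on the slack `n` of the potential: `card α ≤ satPot U + n`
  suffices H : ∀ n : ℕ, ∀ V : Finset α, IsUpperSet (V : Set α) → Fintype.card α ≤ satPot A B V + n →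
      0 ≤ latticeE3 μ V A B from
    H (Fintype.card α) U hU (Nat.le_add_left _ _)
  intro n
  induction n with
  | zero =>
    intro V hV hcard
    by_cases h1 : coreSat A B V = V
    · by_cases h2 : genSat A B V = V
      · exact hsat V hV h1 h2
      · have := satPot_lt_genSat (A := A) (B := B) hV h2
        have := satPot_le_card A B (genSat A B V)
        omega
    · have := satPot_lt_coreSat (A := A) (B := B) hV h1
      have := satPot_le_card A B (coreSat A B V)
      omega
  | succ n ih =>
    intro V hV hcard
    by_cases h1 : coreSat A B V = V
    · by_cases h2 : genSat A B V = V
      · exact hsat V hV h1 h2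
      · have hlt := satPot_lt_genSat (A := A) (B := B) hV h2
        have hrec := ih (genSat A B V) (isUpperSet_genSat A B V) (by omega)
        exact le_trans hrec (latticeE3_genSat_le hμ₀ hV)
    · have hlt := satPot_lt_coreSat (A := A) (B := B) hV h1
      have hrec := ih (coreSat A B V) (isUpperSet_coreSat A B V) (by omega)
      exact le_trans hrec (latticeE3_coreSat_le hμ₀ hμ hV hA hB)

end SaturationLattice

end Summit.CriticalPhenomena.PercolationContinuityZ3.Theorems.C3Transport
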